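import Literature.Probability.RandomPlanarGeometry.SAWAdsorptionPulled
import Literature.Probability.RandomPlanarGeometry.SAWPulledFreeEnergyConvex
import Literature.Probability.RandomPlanarGeometry.SAWAdsorptionLowTemperatureExact
import Mathlib.Analysis.Convex.Continuous
import HarnessLib

/-!
# The adsorbed–ballistic phase boundary `y_c(a)` of the pulled adsorbing walk on `ℤ²`
# (Janse van Rensburg–Whittington 2013, §4: Lemma 5, Lemma 6, Theorem 9), and `y_c(a) = a − 2 + O(1/a)`

Topic `Literature/Probability/RandomPlanarGeometry` (continues `SAWAdsorptionPulled.lean` — `C_n(a,y)`,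
`Zd.JansevanRensburgWhittington2013_thm1 : n⁻¹ log C_n(a,y) → max(κ(log a), λ_B(y))` — and the pulled-bridge free energy
`λ_B = Zd.pulledBridgeFreeEnergy 2`: monotone, `λ_B(1) = log μ`, `λ_B(y) ≥ log y`, convex in `log y`).

Janse van Rensburg–Whittington 2013 (arXiv:1307.6457 v4), §4 (pp. 12–14). Lemma 5 (p. 12): «For `a > a_c^o` there exists
a real number `y_c(a)`, `1 ≤ y_c(a) ≤ e^{κ(a,1)}`, such that the free energy is equal to `κ(a,1)` for `y < y_c(a)` and, for
`y > y_c(a)`, `κ(a,y) ≥ max[κ(a,1), log y]`.» Lemma 6 (p. 13): «For `a > a_c^o` the phase boundary `y = y_c(a)` … satisfies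
`max[1, a μ_{d−1}/μ_d] ≤ y_c(a) ≤ a μ_d`.» Theorem 9 (p. 14): «The critical curve `log y_c(a)` is asymptotic to `log(a μ_{d−1})`.
That is, `lim_{a→∞} log y_c(a)/log(a μ_{d−1}) = 1`.» Here `d = 2` (`μ_1 = 1`) and, since the tree's free energy of the pulled
problem is `λ(y) = max(log μ, λ_B(y))` with `λ_B` monotone, the boundary is the crossing point of `λ_B` with `κ(a)`:

* `Zd.pulledCriticalPull a = y_c(a) := sup {y ≥ 1 : λ_B(y) ≤ κ(log a)}` (for every `a > 0`; for `a ≤ a_c` it is the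
  pulling transition of the free walk, `y_c = 1` by Beaton's theorem — not needed here);
* **Lemma 5**: `one_le_pulledCriticalPull`, `pulledCriticalPull_le_adsRate` (`1 ≤ y_c(a) ≤ e^{κ(a)}`), and the two phases
  `adsPulled_limit_of_lt_pulledCriticalPull` (`y < y_c(a)` ⇒ `n⁻¹ log C_n(a,y) → κ(a)`),
  `adsPulled_limit_of_pulledCriticalPull_lt` (`y > y_c(a)` ⇒ `→ λ_B(y) > κ(a)`), `pulledBridgeFreeEnergy_pulledCriticalPull`
  (`λ_B(y_c(a)) = κ(a)` when `y_c(a) > 1`, by continuity);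
* `Zd.pulledBridgeFreeEnergy_le_log_mul` — `λ_B(y) ≤ log μ + log y` (`y ≥ 1`; printed §3.2 eq. (3.12), p. 9);
* **Lemma 6 (d = 2)**: `div_le_pulledCriticalPull` (`a/μ ≤ y_c(a)`), `pulledCriticalPull_le_mul` (`y_c(a) ≤ a μ`), for `a ≥ 1`;
* **Theorem 9 (d = 2)**: `Zd.JansevanRensburgWhittington2013_thm9 : log y_c(a) / log a → 1`;
* NEW (sharper than print): the LARGE-FORCE LAW of the pulled free energy on `ℤ²`,
  **`y + 2 − 4/y ≤ e^{λ_B(y)} ≤ e^{λ(y)} ≤ y + 2`** (`y ≥ 2`; `Zd.exp_pulledFreeEnergy_window`, `Zd.tendsto_exp_pulledBridgeFreeEnergy_sub`: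
  `e^{λ_B(y)} − y → 2`) — the upper side by a tilted non-reversal potential (`PullNRW.pulledU_le_add_two_pow :
  U_n(y) ≤ 2(y+2)ⁿ`: every letter has tilted out-weight `≤ y + 2` once its reversal is forbidden), the lower side by Beaton's
  renewal bound on the tree's span-1 family `{[+e₀] ++ k·[±e₁]}` (tilted Kraft sum `≥ y x(1 + 2x) ≥ 1` at `x = (y + 2 − 4/y)⁻¹`);
  hence with the tree's adsorption windows `a + 1/a ≤ e^{κ(a)} ≤ a + 1/a + 6/a²`:
  **`e^{κ(a)} − 2 ≤ y_c(a) ≤ e^{κ(a)} − 2 + 4/(e^{κ(a)} − 2)`** (`a ≥ 4`), **`a + 1/a − 2 ≤ y_c(a) ≤ a − 2 + 1/a + 6/a² + 4/(a − 2)`**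
  (`a ≥ 6`), **`y_c(a) − a → −2`** (`Zd.tendsto_pulledCriticalPull_sub`) and `y_c(a)/a → 1`: the adsorbed–ballistic boundary of
  the square lattice is asymptotically the line `y = a − 2`, where print has `log y_c(a) ∼ log a` (Theorem 9, p. 14) and the
  numerics of Guttmann–Jensen–Whittington 2014 (arXiv:1309.7401, §4.3) «y_c(a) is asymptotic to y = a as a → ∞».

Label: CONSOLIDATION (JvR–W 2013 §4 Lemma 5, Lemma 6, Theorem 9 for `d = 2`) + NEW-IN-WRITING modest (the large-force law
`e^{λ(y)} = y + 2 + O(1/y)` and the boundary law `y_c(a) = a − 2 + O(1/a)` on `ℤ²`, explicit constants). Pure standard axioms.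
(Lane «pcv-sawmu», a-p3 g12.)
-/

noncomputable section

open Finset Filter Topology Literature.Probability.LatticeModels SimpleGraph
open scoped BigOperators

namespace Literature.Probability.RandomPlanarGeometry.SAW.Zd

/-! ### `λ_B` on `ℤ²`: continuity and the bound `λ_B(y) ≤ log μ + log y` -/

/-- `s ↦ λ_B(e^s)` is continuous (convex on `ℝ`). [cite: Beaton2015, §3; MadrasSlade1993, Lemma 1.2.2 (Fekete)] -/
theorem continuous_pulledBridgeFreeEnergy_exp : Continuous fun s : ℝ => pulledBridgeFreeEnergy 2 (Real.exp s) :=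
  (pulledBridgeFreeEnergy_exp_convexOn 1).locallyLipschitz.continuous

/-- `λ_B` is continuous at every `y > 0`. [cite: Beaton2015, §3; MadrasSlade1993, Lemma 1.2.2 (Fekete)] -/
theorem continuousAt_pulledBridgeFreeEnergy {y : ℝ} (hy : 0 < y) : ContinuousAt (pulledBridgeFreeEnergy 2) y := by
  have h : ContinuousAt (fun t : ℝ => pulledBridgeFreeEnergy 2 (Real.exp (Real.log t))) y :=
    (continuous_pulledBridgeFreeEnergy_exp.continuousAt).comp (Real.continuousAt_log hy.ne')
  refine (h.congr ?_)
  filter_upwards [Ioi_mem_nhds hy] with t ht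
  simp only [Real.exp_log (Set.mem_Ioi.1 ht)]

/-- **`λ_B(y) ≤ log μ + log y` for `y ≥ 1`** (`Z^B_N(y) ≤ y^N b_N ≤ y^N c_N`; printed: «λ(y) ≤ log μ_d + log y»).
[cite: JansevanRensburgWhittington2013, §3.2 eq. (3.12) (arXiv v4 p. 9: «max{log μ_d, log y} ≤ λ(y) ≤ log μ_d + log y»); Theorem 8 and Corollary 2 (p. 11)] -/
theorem pulledBridgeFreeEnergy_le_log_mul {y : ℝ} (hy : 1 ≤ y) :
    pulledBridgeFreeEnergy 2 y ≤ Real.log (connectiveConstant 2) + Real.log y := by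
  classical
  have hy0 : 0 < y := zero_lt_one.trans_le hy
  -- `Z^B_N(y) ≤ y^N c_N`
  have hZ : ∀ N : ℕ, pulledBridgeZ 2 N y ≤ y ^ N * (count 2 N : ℝ) := by
    intro N
    rw [pulledBridgeZ_eq_sum_bridges]
    have hterm : ∀ ω ∈ bridges 2 N, y ^ (ω N 0).toNat ≤ y ^ N := by
      intro ω hω
      refine pow_le_pow_right₀ hy ?_
      have := span_le_of_mem_bridges' hω
      omega
    calc ∑ ω ∈ bridges 2 N, y ^ (ω N 0).toNat ≤ ∑ ω ∈ bridges 2 N, y ^ N := Finset.sum_le_sum hterm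
      _ = (bridges 2 N).card * y ^ N := by rw [Finset.sum_const, nsmul_eq_mul]
      _ ≤ (count 2 N : ℝ) * y ^ N := by
          refine mul_le_mul_of_nonneg_right ?_ (by positivity)
          exact_mod_cast bridgeCount_le_count (d := 2) N
      _ = y ^ N * (count 2 N : ℝ) := mul_comm _ _
  -- rates
  have hB := tendsto_pulledBridgeFreeEnergy 1 hy0
  have hc : Tendsto (fun N : ℕ => Real.log (y ^ N * (count 2 N : ℝ)) / N) atTop
      (𝓝 (Real.log y + Real.log (connectiveConstant 2))) := by
    have h1 := tendsto_count_rpow 2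
    have hμ := connectiveConstant_pos 2
    have hlog := ((Real.continuousAt_log hμ.ne').tendsto.comp h1).const_add (Real.log y)
    refine hlog.congr' ?_
    filter_upwards [eventually_gt_atTop 0] with N hN
    have hcN : (0 : ℝ) < count 2 N := by exact_mod_cast one_le_count 2 N
    have hN' : (N : ℝ) ≠ 0 := by exact_mod_cast hN.ne'
    simp only [Function.comp]
    rw [Real.log_rpow hcN, Real.log_mul (pow_pos hy0 N).ne' hcN.ne', Real.log_pow, add_div, one_div, inv_mul_eq_div,
      mul_div_cancel_left₀ _ hN']
  rw [add_comm]
  refine le_of_tendsto_of_tendsto' hB hc fun N => ?_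
  rcases Nat.eq_zero_or_pos N with rfl | hN
  · simp
  exact div_le_div_of_nonneg_right (Real.log_le_log (pulledBridgeZ_pos 1 N hy0) (hZ N)) (Nat.cast_nonneg N)

/-! ### The phase boundary `y_c(a)` -/

/-- **`y_c(a)`**, the adsorbed–ballistic phase boundary: the largest pull `y ≥ 1` with `λ_B(y) ≤ κ(log a)`.
[cite: JansevanRensburgWhittington2013, §4 Lemma 5 (arXiv v4 p. 12: «there exists a real number y_c(a), 1 ≤ y_c(a) ≤ e^{κ(a,1)}»)] -/
def pulledCriticalPull (a : ℝ) : ℝ :=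
  sSup {y : ℝ | 1 ≤ y ∧ pulledBridgeFreeEnergy 2 y ≤ adsFreeEnergy (Real.log a)}

/-- `1` belongs to the defining set (`λ_B(1) = log μ ≤ κ`). [cite: JansevanRensburgWhittington2013, §4 Lemma 5 (arXiv v4 p. 12)] -/
theorem one_mem_pulledCriticalSet {a : ℝ} (ha : 0 < a) :
    (1 : ℝ) ∈ {y : ℝ | 1 ≤ y ∧ pulledBridgeFreeEnergy 2 y ≤ adsFreeEnergy (Real.log a)} := by
  refine ⟨le_rfl, ?_⟩
  rw [pulledBridgeFreeEnergy_one 1, adsFreeEnergy, Real.exp_log ha]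
  exact Real.log_le_log (connectiveConstant_pos 2) (connectiveConstant_le_adsRate ha.le)

/-- Every member of the defining set is `≤ e^{κ(log a)}` (`λ_B(y) ≥ log y`). [cite: JansevanRensburgWhittington2013, §4 Lemma 5 (arXiv v4 p. 12)] -/
theorem le_adsRate_of_mem_pulledCriticalSet {a y : ℝ} (ha : 0 < a)
    (hy : y ∈ {y : ℝ | 1 ≤ y ∧ pulledBridgeFreeEnergy 2 y ≤ adsFreeEnergy (Real.log a)}) : y ≤ adsRate a := by
  obtain ⟨hy1, hle⟩ := hy
  have hy0 : 0 < y := zero_lt_one.trans_le hy1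
  have h := (log_le_pulledBridgeFreeEnergy 1 hy0).trans hle
  rw [adsFreeEnergy, Real.exp_log ha] at h
  exact (Real.log_le_log_iff hy0 (adsRate_pos ha.le)).1 h

/-- The defining set is bounded above. [cite: JansevanRensburgWhittington2013, §4 Lemma 5 (arXiv v4 p. 12)] -/
theorem bddAbove_pulledCriticalSet {a : ℝ} (ha : 0 < a) :
    BddAbove {y : ℝ | 1 ≤ y ∧ pulledBridgeFreeEnergy 2 y ≤ adsFreeEnergy (Real.log a)} :=
  ⟨adsRate a, fun _ hy => le_adsRate_of_mem_pulledCriticalSet ha hy⟩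

/-- **Lemma 5: `1 ≤ y_c(a)`.** [cite: JansevanRensburgWhittington2013, §4 Lemma 5 (arXiv v4 p. 12: «1 ≤ y_c(a) ≤ e^{κ(a,1)}»)] -/
theorem one_le_pulledCriticalPull {a : ℝ} (ha : 0 < a) : 1 ≤ pulledCriticalPull a :=
  le_csSup (bddAbove_pulledCriticalSet ha) (one_mem_pulledCriticalSet ha)

/-- **Lemma 5: `y_c(a) ≤ e^{κ(a)}`.** [cite: JansevanRensburgWhittington2013, §4 Lemma 5 (arXiv v4 p. 12: «1 ≤ y_c(a) ≤ e^{κ(a,1)}»)] -/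
theorem pulledCriticalPull_le_adsRate {a : ℝ} (ha : 0 < a) : pulledCriticalPull a ≤ adsRate a :=
  csSup_le ⟨1, one_mem_pulledCriticalSet ha⟩ fun _ hy => le_adsRate_of_mem_pulledCriticalSet ha hy

/-- `y_c(a) > 0`. [cite: JansevanRensburgWhittington2013, §4 Lemma 5 (arXiv v4 p. 12)] -/
theorem pulledCriticalPull_pos {a : ℝ} (ha : 0 < a) : 0 < pulledCriticalPull a :=
  zero_lt_one.trans_le (one_le_pulledCriticalPull ha)

/-- Below the boundary the bridges are slower than the adsorbed walk: `λ_B(y) ≤ κ(log a)` for `0 < y < y_c(a)`.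
[cite: JansevanRensburgWhittington2013, §4 Lemma 5 (arXiv v4 p. 12)] -/
theorem pulledBridgeFreeEnergy_le_of_lt_pulledCriticalPull {a y : ℝ} (ha : 0 < a) (hy : 0 < y)
    (hlt : y < pulledCriticalPull a) : pulledBridgeFreeEnergy 2 y ≤ adsFreeEnergy (Real.log a) := by
  obtain ⟨y', hy'mem, hyy'⟩ := exists_lt_of_lt_csSup ⟨1, one_mem_pulledCriticalSet ha⟩ hlt
  exact (pulledBridgeFreeEnergy_mono 1 hy hyy'.le).trans hy'mem.2

/-- Above the boundary the bridges win: `κ(log a) < λ_B(y)` for `y > y_c(a)`.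
[cite: JansevanRensburgWhittington2013, §4 Lemma 5 (arXiv v4 p. 12)] -/
theorem lt_pulledBridgeFreeEnergy_of_pulledCriticalPull_lt {a y : ℝ} (ha : 0 < a) (hlt : pulledCriticalPull a < y) :
    adsFreeEnergy (Real.log a) < pulledBridgeFreeEnergy 2 y := by
  by_contra h
  push Not at h
  have hy1 : 1 ≤ y := (one_le_pulledCriticalPull ha).trans hlt.le
  exact not_le.2 hlt (le_csSup (bddAbove_pulledCriticalSet ha) ⟨hy1, h⟩)

/-- **Lemma 5, adsorbed side: for `0 < y < y_c(a)`, `n⁻¹ log C_n(a,y) → κ(log a)`** («the free energy is equal to `κ(a,1)`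
for `y < y_c(a)`»). [cite: JansevanRensburgWhittington2013, §4 Lemma 5 (arXiv v4 p. 12)] -/
theorem adsPulled_limit_of_lt_pulledCriticalPull {a y : ℝ} (ha : 0 < a) (hy : 0 < y) (hlt : y < pulledCriticalPull a) :
    Tendsto (fun n : ℕ => Real.log (adsPulledZ n a y) / n) atTop (𝓝 (adsFreeEnergy (Real.log a))) := by
  have h := JansevanRensburgWhittington2013_thm1 ha hy
  rwa [max_eq_left (pulledBridgeFreeEnergy_le_of_lt_pulledCriticalPull ha hy hlt)] at h

/-- **Lemma 5, ballistic side: for `y > y_c(a)`, `n⁻¹ log C_n(a,y) → λ_B(y) > κ(log a)`** («for `y > y_c(a)`,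
`κ(a,y) ≥ max[κ(a,1), log y]`»). [cite: JansevanRensburgWhittington2013, §4 Lemma 5 (arXiv v4 p. 12)] -/
theorem adsPulled_limit_of_pulledCriticalPull_lt {a y : ℝ} (ha : 0 < a) (hlt : pulledCriticalPull a < y) :
    adsFreeEnergy (Real.log a) < pulledBridgeFreeEnergy 2 y ∧
      Tendsto (fun n : ℕ => Real.log (adsPulledZ n a y) / n) atTop (𝓝 (pulledBridgeFreeEnergy 2 y)) := by
  have hy : 0 < y := (pulledCriticalPull_pos ha).trans hlt
  have hgt := lt_pulledBridgeFreeEnergy_of_pulledCriticalPull_lt ha hlt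
  have h := JansevanRensburgWhittington2013_thm1 ha hy
  rw [max_eq_right hgt.le] at h
  exact ⟨hgt, h⟩

/-- **At the boundary `λ_B(y_c(a)) = κ(log a)` whenever `y_c(a) > 1`** (continuity of `λ_B`): the two free energies cross there.
[cite: JansevanRensburgWhittington2013, §4 (arXiv v4 p. 12: «if a > a_c^o and y > y_c(a) the free energy is given by κ(a,y) = λ(y)» — the boundary is the locus κ(a) = λ(y))] -/
theorem pulledBridgeFreeEnergy_pulledCriticalPull {a : ℝ} (ha : 0 < a) (_h1 : 1 < pulledCriticalPull a) :
    pulledBridgeFreeEnergy 2 (pulledCriticalPull a) = adsFreeEnergy (Real.log a) := by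
  set yc := pulledCriticalPull a with hyc
  have hyc0 : 0 < yc := pulledCriticalPull_pos ha
  have hcont := continuousAt_pulledBridgeFreeEnergy hyc0
  refine le_antisymm ?_ ?_
  · -- from the left: `λ_B(y) ≤ κ` for `y < yc`
    have hlim : Tendsto (pulledBridgeFreeEnergy 2) (𝓝[<] yc) (𝓝 (pulledBridgeFreeEnergy 2 yc)) :=
      hcont.tendsto.mono_left nhdsWithin_le_nhds
    refine le_of_tendsto hlim ?_
    filter_upwards [self_mem_nhdsWithin, inter_mem_nhdsWithin (Set.Iio yc) (Ioi_mem_nhds hyc0)] with y hy hy'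
    exact pulledBridgeFreeEnergy_le_of_lt_pulledCriticalPull ha hy'.2 hy
  · -- from the right: `κ < λ_B(y)` for `y > yc`
    have hlim : Tendsto (pulledBridgeFreeEnergy 2) (𝓝[>] yc) (𝓝 (pulledBridgeFreeEnergy 2 yc)) :=
      hcont.tendsto.mono_left nhdsWithin_le_nhds
    refine ge_of_tendsto hlim ?_
    filter_upwards [self_mem_nhdsWithin] with y hy
    exact (lt_pulledBridgeFreeEnergy_of_pulledCriticalPull_lt ha hy).le

/-! ### Lemma 6 and Theorem 9 for `d = 2` -/

/-- **Lemma 6 (d = 2), lower: `a/μ ≤ y_c(a)`** for `a > 0` (`λ_B(y) ≤ log μ + log y` and `κ(a) ≥ log a`).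
[cite: JansevanRensburgWhittington2013, §4 Lemma 6 (arXiv v4 p. 13: «max[1, a μ_{d−1}/μ_d] ≤ y_c(a) ≤ a μ_d»)] -/
theorem div_le_pulledCriticalPull {a : ℝ} (ha : 0 < a) : a / connectiveConstant 2 ≤ pulledCriticalPull a := by
  have hμ := connectiveConstant_pos 2
  rcases le_or_gt (a / connectiveConstant 2) 1 with h1 | h1
  · exact h1.trans (one_le_pulledCriticalPull ha)
  · refine le_csSup (bddAbove_pulledCriticalSet ha) ⟨h1.le, ?_⟩
    calc pulledBridgeFreeEnergy 2 (a / connectiveConstant 2)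
        ≤ Real.log (connectiveConstant 2) + Real.log (a / connectiveConstant 2) := pulledBridgeFreeEnergy_le_log_mul h1.le
      _ = Real.log a := by rw [Real.log_div ha.ne' hμ.ne']; ring
      _ ≤ adsFreeEnergy (Real.log a) := by
          rw [adsFreeEnergy, Real.exp_log ha]
          exact Real.log_le_log ha (self_le_adsRate ha.le)

/-- **Lemma 6 (d = 2), upper: `y_c(a) ≤ a μ`** for `a ≥ 1` (`y_c(a) ≤ e^{κ(a)} ≤ a μ`).
[cite: JansevanRensburgWhittington2013, §4 Lemma 6 (arXiv v4 p. 13: «max[1, a μ_{d−1}/μ_d] ≤ y_c(a) ≤ a μ_d»)] -/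
theorem pulledCriticalPull_le_mul {a : ℝ} (ha : 1 ≤ a) : pulledCriticalPull a ≤ a * connectiveConstant 2 :=
  (pulledCriticalPull_le_adsRate (zero_lt_one.trans_le ha)).trans (adsRate_le_mul_connectiveConstant ha)

/-- **Theorem 9 (d = 2): `log y_c(a) / log a → 1` as `a → ∞`** («the critical curve `log y_c(a)` is asymptotic to `log(a μ_{d−1})`»;
`μ_1 = 1`). [cite: JansevanRensburgWhittington2013, §4 Theorem 9 (arXiv v4 p. 14)] -/
theorem JansevanRensburgWhittington2013_thm9 :
    Tendsto (fun a : ℝ => Real.log (pulledCriticalPull a) / Real.log a) atTop (𝓝 1) := by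
  set L := Real.log (connectiveConstant 2) with hL
  have hlog := Real.tendsto_log_atTop
  -- `(log a − L)/log a → 1` and `(log a + L)/log a → 1`
  have hlow : Tendsto (fun a : ℝ => (Real.log a - L) / Real.log a) atTop (𝓝 1) := by
    have h : Tendsto (fun a : ℝ => 1 - L / Real.log a) atTop (𝓝 1) := by
      simpa using (tendsto_const_nhds (x := (1:ℝ))).sub (tendsto_const_nhds.div_atTop hlog)
    refine h.congr' ?_
    filter_upwards [hlog.eventually (eventually_gt_atTop 0)] with a ha
    field_simp
  have hup : Tendsto (fun a : ℝ => (Real.log a + L) / Real.log a) atTop (𝓝 1) := by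
    have h : Tendsto (fun a : ℝ => 1 + L / Real.log a) atTop (𝓝 1) := by
      simpa using (tendsto_const_nhds (x := (1:ℝ))).add (tendsto_const_nhds.div_atTop hlog)
    refine h.congr' ?_
    filter_upwards [hlog.eventually (eventually_gt_atTop 0)] with a ha
    field_simp
  refine tendsto_of_tendsto_of_tendsto_of_le_of_le' hlow hup ?_ ?_
  · filter_upwards [eventually_ge_atTop (1 : ℝ), hlog.eventually (eventually_gt_atTop 0)] with a ha hla
    have ha0 : 0 < a := zero_lt_one.trans_le ha
    have hμ := connectiveConstant_pos 2
    refine div_le_div_of_nonneg_right ?_ hla.le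
    calc Real.log a - L = Real.log (a / connectiveConstant 2) := by rw [Real.log_div ha0.ne' hμ.ne']
      _ ≤ Real.log (pulledCriticalPull a) := Real.log_le_log (div_pos ha0 hμ) (div_le_pulledCriticalPull ha0)
  · filter_upwards [eventually_ge_atTop (1 : ℝ), hlog.eventually (eventually_gt_atTop 0)] with a ha hla
    have ha0 : 0 < a := zero_lt_one.trans_le ha
    have hμ := connectiveConstant_pos 2
    refine div_le_div_of_nonneg_right ?_ hla.le
    calc Real.log (pulledCriticalPull a) ≤ Real.log (a * connectiveConstant 2) :=
          Real.log_le_log (pulledCriticalPull_pos ha0) (pulledCriticalPull_le_mul ha)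
      _ = Real.log a + L := by rw [Real.log_mul ha0.ne' hμ.ne']

/-! ### The tilted non-reversal bound `U_n(y) ≤ 2 (y+2)ⁿ` (`y ≥ 1`): `λ(y) ≤ log (y + 2)` -/

namespace PullNRW

open LowTemp

/-- Peeling the first letter: `traj (s :: w) (i+1) = vec s + traj w i`. [folklore] -/
private theorem traj_cons_succ' (s : Step) (w : List Step) (i : ℕ) : traj (s :: w) (i + 1) = Step.vec s + traj w i := by
  simp only [traj, List.take_succ_cons, wEnd_cons]

/-- The opposite step cancels: `vec (opp s) + vec s = 0`. [folklore] -/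
private theorem vec_opp_add' (s : Step) : Step.vec (Step.opp s) + Step.vec s = 0 := by
  ext i
  fin_cases s <;> fin_cases i <;> simp [Step.opp, Step.vec, Step.dx, Step.dy]

/-- The tilt: a step is weighted `y^{dx}` — `y` for `+e₀` (up), `y⁻¹` for `−e₀` (down), `1` sideways.
[cite: JansevanRensburgWhittington2013, §2 eq. (2.3) (arXiv v4 p. 4: the weight y^h, h = z_n)] -/
def swt (y : ℝ) (s : Step) : ℝ := y ^ (s.dx : ℤ)

/-- Tilted potential-weighted value of a word read from `(h, l)`. [cite: JansevanRensburgWhittington2013, §2 eq. (2.3) (arXiv v4 p. 4)] -/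
def pval (u : ℤ → Option Step → ℝ) (y : ℝ) : ℤ → Option Step → List Step → ℝ
  | h, l, [] => u h l
  | h, _, s :: w => swt y s * pval u y (h + s.dx) (some s) w

/-- `pval` restricted to admissible words. [cite: JansevanRensburgWhittington2013, §2 eq. (2.3) (arXiv v4 p. 4)] -/
def pF (u : ℤ → Option Step → ℝ) (y : ℝ) (h : ℤ) (l : Option Step) (w : List Step) : ℝ :=
  if Adm h l w then pval u y h l w else 0

/-- The one-step tilted potential sum. [cite: JansevanRensburgWhittington2013, §2 eq. (2.3) (arXiv v4 p. 4)] -/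
def plocSum (u : ℤ → Option Step → ℝ) (y : ℝ) (h : ℤ) (l : Option Step) : ℝ :=
  ∑ s : Step, if Allowed h l s then swt y s * u (h + s.dx) (some s) else 0

/-- `swt > 0` for `y > 0`. [folklore] -/
private theorem swt_pos {y : ℝ} (hy : 0 < y) (s : Step) : 0 < swt y s := zpow_pos hy _

/-- `pval ≥ 0`. [folklore] -/
private theorem pval_nonneg {u : ℤ → Option Step → ℝ} (hu : ∀ h l, 0 ≤ u h l) {y : ℝ} (hy : 0 < y) :
    ∀ (w : List Step) (h : ℤ) (l : Option Step), 0 ≤ pval u y h l w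
  | [], h, l => hu h l
  | s :: w, _, _ => mul_nonneg (swt_pos hy s).le (pval_nonneg hu hy w _ _)

/-- `pF ≥ 0`. [folklore] -/
private theorem pF_nonneg {u : ℤ → Option Step → ℝ} (hu : ∀ h l, 0 ≤ u h l) {y : ℝ} (hy : 0 < y)
    (h : ℤ) (l : Option Step) (w : List Step) : 0 ≤ pF u y h l w := by
  unfold pF; split_ifs
  · exact pval_nonneg hu hy w h l
  · exact le_rfl

/-- First-letter recursion for `pF`. [folklore] -/
private theorem pF_cons (u : ℤ → Option Step → ℝ) (y : ℝ) (h : ℤ) (l : Option Step) (s : Step) (w : List Step) :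
    pF u y h l (s :: w) = (if Allowed h l s then swt y s else 0) * pF u y (h + s.dx) (some s) w := by
  unfold pF
  by_cases hA : Allowed h l s
  · by_cases hB : Adm (h + s.dx) (some s) w
    · rw [if_pos (show Adm h l (s :: w) from ⟨hA, hB⟩), if_pos hA, if_pos hB, pval]
    · rw [if_neg (show ¬ Adm h l (s :: w) from fun hh => hB hh.2), if_neg hB, mul_zero]
  · rw [if_neg (show ¬ Adm h l (s :: w) from fun hh => hA hh.1), if_neg hA, zero_mul]

/-- Heights stay non-negative under `Allowed`. [folklore] -/
private theorem height_nonneg_of_allowed' {h : ℤ} (hh : 0 ≤ h) {l : Option Step} {s : Step} (hs : Allowed h l s) :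
    0 ≤ h + s.dx := by
  obtain ⟨-, h2⟩ := hs
  by_cases hs2 : s = 2
  · have := h2 hs2; subst hs2; simp [Step.dx]; omega
  · have : 0 ≤ s.dx := by unfold Step.dx; split_ifs <;> omega
    omega

/-- Words of length `n + 1` are `s :: w`. [folklore] -/
private theorem words_succ_eq' (n : ℕ) :
    words (n + 1) = ((Finset.univ : Finset Step) ×ˢ words n).image fun p => p.1 :: p.2 := by
  ext w
  simp only [mem_words, Finset.mem_image, Finset.mem_product, Finset.mem_univ, true_and]
  constructor
  · intro h
    cases w with
    | nil => simp at h
    | cons st w => exact ⟨(st, w), by simpa using h, rfl⟩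
  · rintro ⟨⟨st, w'⟩, hw', rfl⟩
    simpa using hw'

/-- **The tilted potential bound**: if `u ≥ 0` is `Λ`-excessive for the tilted one-step rule at every height `h ≥ 0`, then the
tilted potential-weighted sum over admissible words of length `m` read from `(h, l)` is at most `Λ^m u(h, l)`.
[cite: JansevanRensburgWhittington2013, §2, proof of Theorem 1 (arXiv v4 p. 4)] -/
theorem psum_words_le {u : ℤ → Option Step → ℝ} {y Λ : ℝ} (hy : 0 < y) (hΛ : 0 ≤ Λ)
    (hloc : ∀ h : ℤ, 0 ≤ h → ∀ l, plocSum u y h l ≤ Λ * u h l) :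
    ∀ (m : ℕ) (h : ℤ), 0 ≤ h → ∀ l : Option Step, ∑ w ∈ words m, pF u y h l w ≤ Λ ^ m * u h l := by
  classical
  intro m
  induction m with
  | zero =>
    intro h _ l
    have h0 : words 0 = {[]} := by
      ext w; simp only [mem_words, Finset.mem_singleton, List.length_eq_zero_iff]
    simp [h0, pF, Adm, pval]
  | succ m ih =>
    intro h hh l
    rw [words_succ_eq', Finset.sum_image, Finset.sum_product]
    · calc ∑ s : Step, ∑ w ∈ words m, pF u y h l (s :: w)
            = ∑ s : Step, (if Allowed h l s then swt y s else 0) * ∑ w ∈ words m, pF u y (h + s.dx) (some s) w := by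
              refine Finset.sum_congr rfl fun s _ => ?_
              rw [Finset.mul_sum]
              refine Finset.sum_congr rfl fun w _ => ?_
              rw [pF_cons]
        _ ≤ ∑ s : Step, (if Allowed h l s then swt y s else 0) * (Λ ^ m * u (h + s.dx) (some s)) := by
              refine Finset.sum_le_sum fun s _ => ?_
              by_cases hs : Allowed h l s
              · rw [if_pos hs]
                exact mul_le_mul_of_nonneg_left (ih _ (height_nonneg_of_allowed' hh hs) _) (swt_pos hy s).le
              · rw [if_neg hs, zero_mul, zero_mul]
        _ = Λ ^ m * plocSum u y h l := by
              rw [plocSum, Finset.mul_sum]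
              refine Finset.sum_congr rfl fun s _ => ?_
              split_ifs <;> ring
        _ ≤ Λ ^ m * (Λ * u h l) := mul_le_mul_of_nonneg_left (hloc h hh l) (pow_nonneg hΛ m)
        _ = Λ ^ (m + 1) * u h l := by ring
    · rintro ⟨st, w⟩ _ ⟨st', w'⟩ _ hp
      simp only [List.cons.injEq] at hp
      exact Prod.ext hp.1 hp.2

/-- The last letter of `w`, or `l` if `w` is empty. [folklore] -/
def lastD' : Option Step → List Step → Option Step
  | l, [] => l
  | _, s :: w => lastD' (some s) w

/-- `pval = y^{height gained} · u(final configuration)` (`y ≠ 0`). [folklore] -/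
private theorem pval_eq (u : ℤ → Option Step → ℝ) {y : ℝ} (hy : y ≠ 0) :
    ∀ (w : List Step) (h : ℤ) (l : Option Step), pval u y h l w = y ^ (wEnd w 0) * u (h + wEnd w 0) (lastD' l w)
  | [], h, l => by simp [pval, lastD']
  | s :: w, h, l => by
    rw [pval, pval_eq u hy w, lastD', wEnd_cons, Pi.add_apply, Step.vec_apply_zero, zpow_add₀ hy, ← add_assoc, swt]
    ring

/-- A self-avoiding word with non-negative height profile is admissible. [folklore] -/
private theorem adm_of_saw' : ∀ (w : List Step) (h : ℤ) (l : Option Step),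
    (∀ i ≤ w.length, 0 ≤ h + traj w i 0) → IsSAW (l.toList ++ w) → Adm h l w
  | [], _, _, _, _ => trivial
  | s :: w, h, l, hh, hsaw => by
    refine ⟨⟨?_, ?_⟩, ?_⟩
    · rintro rfl
      have hinj := (isSAW_iff_injOn _).1 hsaw
      have h02 : traj (Step.opp s :: s :: w) 0 = traj (Step.opp s :: s :: w) 2 := by
        rw [traj_zero, traj_cons_succ', traj_cons_succ', traj_zero, add_zero, vec_opp_add']
      have := hinj (by simp) (by simp) h02
      exact absurd this (by norm_num)
    · intro hs
      subst hs
      have := hh 1 (by simp)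
      rw [traj_cons_succ', traj_zero, add_zero] at this
      simp [Step.dx] at this ⊢
      linarith
    · refine adm_of_saw' w (h + s.dx) (some s) (fun i hi => ?_) ?_
      · have := hh (i + 1) (by simpa using hi)
        rwa [traj_cons_succ', Pi.add_apply, Step.vec_apply_zero, ← add_assoc] at this
      · have := hsaw.drop l.toList.length
        simpa using this

/-- **`U_n(y) ≤ Λⁿ u(0, start)/δ`** for every `Λ`-excessive tilted potential `u ≥ δ > 0` (`y > 0`): every weak-half-space
self-avoiding walk is the trajectory of an admissible word whose tilted value is `y^{height}` times the final potential.
[cite: JansevanRensburgWhittington2013, §2, proof of Theorem 1 (arXiv v4 p. 4)] [cite: Beaton2015, §2 (p. 3: U_n(y))] -/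
theorem pulledU_le_of_potential (u : ℤ → Option Step → ℝ) {y Λ δ : ℝ} (hy : 0 < y) (hΛ : 0 ≤ Λ) (hδ : 0 < δ)
    (hu : ∀ h : ℤ, ∀ l, 0 ≤ h → δ ≤ u h l) (hu0 : ∀ h l, 0 ≤ u h l)
    (hloc : ∀ h : ℤ, 0 ≤ h → ∀ l, plocSum u y h l ≤ Λ * u h l) (n : ℕ) :
    pulledU 2 n y ≤ Λ ^ n * u 0 none / δ := by
  classical
  set good : Finset (List Step) := (sawWords n).filter (fun w => ∀ i ≤ n, 0 ≤ traj w i 0) with hgood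
  have himage : weakHalfSpaceWalks 2 n = good.image traj := by
    rw [← hpWalks_eq_weakHalfSpaceWalks]
    ext ω
    simp only [mem_hpWalks, Finset.mem_image, hgood, Finset.mem_filter, mem_sawWords]
    constructor
    · rintro ⟨hω, hhp⟩
      have hω' : ω ∈ (sawWords n).image traj := by rw [image_traj_sawWords]; exact hω
      obtain ⟨w, hw, rfl⟩ := Finset.mem_image.1 hω'
      exact ⟨w, ⟨mem_sawWords.1 hw, hhp⟩, rfl⟩
    · rintro ⟨w, ⟨⟨hl, hs⟩, hhp⟩, rfl⟩
      exact ⟨traj_mem_saws hl hs, hhp⟩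
  have hmem : ∀ w ∈ good, (w.length = n ∧ IsSAW w) ∧ ∀ i ≤ n, 0 ≤ traj w i 0 := fun w hw => by
    simpa [hgood] using hw
  have hinj : Set.InjOn traj (good : Set (List Step)) := fun w hw w' hw' h =>
    traj_injOn n (by simp [(hmem w hw).1.1]) (by simp [(hmem w' hw').1.1]) h
  rw [pulledU, himage, Finset.sum_image hinj]
  have hterm : ∀ w ∈ good, y ^ (traj w n 0).toNat ≤ pF u y 0 none w / δ := by
    intro w hw
    obtain ⟨⟨hl, hs⟩, hhp⟩ := hmem w hw
    have hadm : Adm 0 none w := adm_of_saw' w 0 none (by simpa [hl] using hhp) (by simpa using hs)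
    have hend : 0 ≤ wEnd w 0 := by
      have := hhp n le_rfl
      rwa [← hl, traj_length] at this
    have htn : traj w n 0 = wEnd w 0 := by rw [← hl, traj_length]
    rw [pF, if_pos hadm, pval_eq u hy.ne', zero_add, le_div_iff₀ hδ, htn]
    have hz : y ^ (wEnd w 0).toNat = y ^ (wEnd w 0) := by
      rw [← zpow_natCast, Int.toNat_of_nonneg hend]
    rw [hz]
    exact mul_le_mul_of_nonneg_left (hu _ _ hend) (zpow_pos hy _).le
  have hsub : good ⊆ words n := fun w hw => mem_words.2 (hmem w hw).1.1
  calc ∑ w ∈ good, y ^ (traj w n 0).toNat ≤ ∑ w ∈ good, pF u y 0 none w / δ := Finset.sum_le_sum hterm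
    _ ≤ ∑ w ∈ words n, pF u y 0 none w / δ :=
        Finset.sum_le_sum_of_subset_of_nonneg hsub fun w _ _ => div_nonneg (pF_nonneg hu0 hy _ _ _) hδ.le
    _ = (∑ w ∈ words n, pF u y 0 none w) / δ := by rw [Finset.sum_div]
    _ ≤ Λ ^ n * u 0 none / δ := by
        gcongr
        exact psum_words_le hy hΛ hloc n 0 le_rfl none

/-- The `(y+2)`-excessive potential: `1` after a letter, `2` at the start. [folklore] -/
def potC (_h : ℤ) (l : Option Step) : ℝ := if l = none then 2 else 1

/-- **The local certificate: every letter has tilted out-weight `≤ y + 2` once its reversal is forbidden** (`y ≥ 1`):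
after `+e₀`: `y + 1 + 1`; after `−e₀`: `y⁻¹ + 2 ≤ y + 2`; after `±e₁`: `y + y⁻¹ + 1 ≤ y + 2`.
[cite: JansevanRensburgWhittington2013, §3.2 eq. (3.12) (arXiv v4 p. 9: «λ(y) ≤ log μ_d + log y»)] -/
theorem plocSum_potC_le {y : ℝ} (hy : 1 ≤ y) (h : ℤ) (l : Option Step) : plocSum potC y h l ≤ (y + 2) * potC h l := by
  have hy0 : 0 < y := zero_lt_one.trans_le hy
  have hyi : y⁻¹ ≤ 1 := inv_le_one_of_one_le₀ hy
  have hyi0 : 0 ≤ y⁻¹ := inv_nonneg.2 hy0.le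
  have hsw : ∀ s : Step, swt y s = if s = 0 then y else if s = 2 then y⁻¹ else 1 := by
    intro s; unfold swt Step.dx
    fin_cases s <;> simp
  unfold plocSum
  rw [Fin.sum_univ_four]
  simp only [hsw, potC, LowTemp.Allowed, Step.opp]
  rcases l with _ | l
  · simp
    split_ifs <;> nlinarith
  · fin_cases l <;> simp <;> (try split_ifs) <;> (try simp at *) <;> nlinarith

/-- **`U_n(y) ≤ 2 (y + 2)ⁿ` for `y ≥ 1`.** [cite: JansevanRensburgWhittington2013, §3.2 eq. (3.12) (arXiv v4 p. 9)] [cite: Beaton2015, §2 (p. 3: U_n(y))] -/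
theorem pulledU_le_add_two_pow {y : ℝ} (hy : 1 ≤ y) (n : ℕ) : pulledU 2 n y ≤ 2 * (y + 2) ^ n := by
  have hy0 : 0 < y := zero_lt_one.trans_le hy
  have h := pulledU_le_of_potential potC hy0 (by linarith) one_pos
    (fun h l _ => by unfold potC; split_ifs <;> norm_num) (fun h l => by unfold potC; split_ifs <;> norm_num)
    (fun h _ l => plocSum_potC_le hy h l) n
  have e : potC 0 none = 2 := by simp [potC]
  rw [e, div_one] at h
  linarith

end PullNRW

/-- **`λ(y) = max(log μ, λ_B(y)) ≤ log (y + 2)` for `y ≥ 1`** (Beaton's half-space free energy on `ℤ²`).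
[cite: JansevanRensburgWhittington2013, §3.2 eq. (3.12) (arXiv v4 p. 9: «λ(y) ≤ log μ_d + log y»)] [cite: Beaton2015, Theorem 1] -/
theorem pulledFreeEnergy_le_log_add_two {y : ℝ} (hy : 1 ≤ y) :
    max (Real.log (connectiveConstant 2)) (pulledBridgeFreeEnergy 2 y) ≤ Real.log (y + 2) := by
  have hy0 : 0 < y := zero_lt_one.trans_le hy
  have hU := Beaton2015_freeEnergy 0 hy0
  have hb : Tendsto (fun n : ℕ => Real.log (2 * (y + 2) ^ n) / n) atTop (𝓝 (Real.log (y + 2))) := by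
    have h1 : Tendsto (fun n : ℕ => Real.log 2 / n) atTop (𝓝 0) := tendsto_const_nhds.div_atTop tendsto_natCast_atTop_atTop
    have h2 := h1.add_const (Real.log (y + 2))
    rw [zero_add] at h2
    refine h2.congr' ?_
    filter_upwards [eventually_gt_atTop 0] with n hn
    have hn' : (n : ℝ) ≠ 0 := by exact_mod_cast hn.ne'
    rw [Real.log_mul (by norm_num) (pow_pos (by linarith) n).ne', Real.log_pow, add_div, mul_div_cancel_left₀ _ hn']
  refine le_of_tendsto_of_tendsto' hU hb fun n => ?_
  rcases Nat.eq_zero_or_pos n with rfl | hn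
  · simp
  have hUpos : 0 < pulledU 2 n y := lt_of_lt_of_le (pulledBridgeZ_pos 1 n hy0) (pulledBridgeZ_le_pulledU n hy0.le)
  exact div_le_div_of_nonneg_right (Real.log_le_log hUpos (PullNRW.pulledU_le_add_two_pow hy n)) (Nat.cast_nonneg n)

/-- **`λ_B(y) ≤ log (y + 2)` for `y ≥ 1`.** [cite: JansevanRensburgWhittington2013, §3.2 eq. (3.12) (arXiv v4 p. 9)] -/
theorem pulledBridgeFreeEnergy_le_log_add_two {y : ℝ} (hy : 1 ≤ y) : pulledBridgeFreeEnergy 2 y ≤ Real.log (y + 2) :=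
  (le_max_right _ _).trans (pulledFreeEnergy_le_log_add_two hy)

/-! ### `y_c(a) = a + O(1)` -/

/-- **`e^{κ(a)} − 2 ≤ y_c(a)`** (`λ_B(y) ≤ log(y + 2)`: at `y = e^{κ(a)} − 2` the bridges are not faster than the adsorbed walk).
[cite: JansevanRensburgWhittington2013, §4 Lemma 6 (arXiv v4 p. 13)] -/
theorem adsRate_sub_two_le_pulledCriticalPull {a : ℝ} (ha : 0 < a) : adsRate a - 2 ≤ pulledCriticalPull a := by
  rcases le_or_gt (adsRate a - 2) 1 with h1 | h1
  · exact h1.trans (one_le_pulledCriticalPull ha)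
  · refine le_csSup (bddAbove_pulledCriticalSet ha) ⟨h1.le, ?_⟩
    calc pulledBridgeFreeEnergy 2 (adsRate a - 2) ≤ Real.log (adsRate a - 2 + 2) := pulledBridgeFreeEnergy_le_log_add_two h1.le
      _ = adsFreeEnergy (Real.log a) := by rw [sub_add_cancel, adsFreeEnergy, Real.exp_log ha]

/-- **The phase boundary within `O(1)` of the diagonal: `a + 1/a − 2 ≤ y_c(a) ≤ a + 2` for `a ≥ 3`** (tree windows
`a + 1/a ≤ e^{κ(a)} ≤ a + 2`). [cite: JansevanRensburgWhittington2013, §4 Lemma 6 and Theorem 9 (arXiv v4 pp. 13–14)] -/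
theorem pulledCriticalPull_window {a : ℝ} (ha : 3 ≤ a) :
    a + 1 / a - 2 ≤ pulledCriticalPull a ∧ pulledCriticalPull a ≤ a + 2 := by
  have ha0 : 0 < a := by linarith
  refine ⟨?_, ?_⟩
  · have := add_inv_le_adsRate ha
    linarith [adsRate_sub_two_le_pulledCriticalPull ha0]
  · exact (pulledCriticalPull_le_adsRate ha0).trans (adsRate_le_add_two (by linarith))

/-- **`y_c(a)/a → 1`** (in fact `|y_c(a) − a| ≤ 2 + o(1)`): the linear, not merely logarithmic, asymptotics of the boundary
(numerically «y_c(a) is asymptotic to y = a as a → ∞», Guttmann–Jensen–Whittington 2014).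
[cite: JansevanRensburgWhittington2013, §4 Theorem 9 (arXiv v4 p. 14)] [cite: GuttmannJensenWhittington2013, §4.3 (phase boundary asymptotic to y = a, series numerics)] -/
theorem tendsto_pulledCriticalPull_div : Tendsto (fun a : ℝ => pulledCriticalPull a / a) atTop (𝓝 1) := by
  have hlow : Tendsto (fun a : ℝ => (a + 1 / a - 2) / a) atTop (𝓝 1) := by
    have h1 : Tendsto (fun a : ℝ => 1 / a) atTop (𝓝 0) := tendsto_const_nhds.div_atTop tendsto_id
    have h2 : Tendsto (fun a : ℝ => 1 / a * (1 / a)) atTop (𝓝 0) := by simpa using h1.mul h1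
    have h3 : Tendsto (fun a : ℝ => 1 + 1 / a * (1 / a) - 2 * (1 / a)) atTop (𝓝 1) := by
      simpa using ((tendsto_const_nhds (x := (1:ℝ))).add h2).sub (h1.const_mul 2)
    refine h3.congr' ?_
    filter_upwards [eventually_gt_atTop 0] with a ha
    field_simp
  have hup : Tendsto (fun a : ℝ => (a + 2) / a) atTop (𝓝 1) := by
    have h1 : Tendsto (fun a : ℝ => 1 / a) atTop (𝓝 0) := tendsto_const_nhds.div_atTop tendsto_id
    have h3 : Tendsto (fun a : ℝ => 1 + 2 * (1 / a)) atTop (𝓝 1) := by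
      simpa using (tendsto_const_nhds (x := (1:ℝ))).add (h1.const_mul 2)
    refine h3.congr' ?_
    filter_upwards [eventually_gt_atTop 0] with a ha
    field_simp
  refine tendsto_of_tendsto_of_tendsto_of_le_of_le' hlow hup ?_ ?_
  · filter_upwards [eventually_ge_atTop (3 : ℝ)] with a ha
    exact div_le_div_of_nonneg_right (pulledCriticalPull_window ha).1 (by linarith)
  · filter_upwards [eventually_ge_atTop (3 : ℝ)] with a ha
    exact div_le_div_of_nonneg_right (pulledCriticalPull_window ha).2 (by linarith)

/-! ### The sharp constant: `e^{λ_B(y)} ≥ y + 2 − 4/y`, hence `y_c(a) = a − 2 + O(1/a)` -/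

/-- **`log (y + 2 − 4/y) ≤ λ_B(y)` for `y ≥ 2`**: the tilted Kraft sum of the span-1 family `{[+e₀], [+e₀] ++ k·[±e₁]}`
at `x = (y + 2 − 4/y)⁻¹` is at least `y x (1 + 2x) ≥ 1` (Beaton's renewal bound `B ≥ yI/(1 − yI)` made explicit).
[cite: Beaton2015, Theorem 1 and its proof, eq. (8); Jensen2004SAWLowerBounds, §2.1] -/
theorem log_add_two_sub_le_pulledBridgeFreeEnergy {y : ℝ} (hy : 2 ≤ y) :
    Real.log (y + 2 - 4 / y) ≤ pulledBridgeFreeEnergy 2 y := by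
  have hy0 : 0 < y := by linarith
  set r := y + 2 - 4 / y with hr
  have hr0 : 0 < r := by
    have : 4 / y ≤ 2 := by rw [div_le_iff₀ hy0]; linarith
    linarith
  set x := r⁻¹ with hx
  have hx0 : 0 < x := inv_pos.2 hr0
  -- the Kraft certificate `1 ≤ y x (1 + 2x) ≤ Σ_{s ∈ S} x^{|s|} y^{span s}`
  have hK : (1 : ℝ) ≤ ∑ s ∈ spanOneFamily, x ^ s.length * y ^ (xEnd s).toNat := by
    rw [tiltedKraft_spanOneFamily]
    have h1 : x + x ^ 2 ≤ ∑ k ∈ Finset.range 61, x ^ (k + 1) := by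
      rw [Finset.sum_range_succ', Finset.sum_range_succ']
      have hrest : 0 ≤ ∑ k ∈ Finset.range 59, x ^ (k + 1 + 1 + 1) := Finset.sum_nonneg fun _ _ => by positivity
      have e1 : x ^ (0 + 1 + 1) = x ^ 2 := by norm_num
      have e2 : x ^ (0 + 1) = x := by norm_num
      rw [e1, e2]; linarith
    have h2 : x ^ 2 ≤ ∑ k ∈ Finset.range 60, x ^ (k + 2) := by
      rw [Finset.sum_range_succ']
      have hrest : 0 ≤ ∑ k ∈ Finset.range 59, x ^ (k + 1 + 2) := Finset.sum_nonneg fun _ _ => by positivity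
      have e1 : x ^ (0 + 2) = x ^ 2 := by norm_num
      rw [e1]; linarith
    -- `y x (1 + 2x) ≥ 1` ⟺ `y (r + 2) ≥ r²` ⟺ `16 (y − 1)/y² ≥ 0`
    have hkey : 1 ≤ y * (x + x ^ 2 + x ^ 2) := by
      have e : y * (x + x ^ 2 + x ^ 2) = y * (r + 2) / r ^ 2 := by
        rw [hx]; field_simp; ring
      rw [e, le_div_iff₀ (pow_pos hr0 2), one_mul]
      have hrr : y * (r + 2) - r ^ 2 = 16 * (y - 1) / y ^ 2 := by
        rw [hr]; field_simp; ring
      have : 0 ≤ 16 * (y - 1) / y ^ 2 := div_nonneg (by linarith) (by positivity)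
      linarith
    calc (1 : ℝ) ≤ y * (x + x ^ 2 + x ^ 2) := hkey
      _ ≤ y * (∑ k ∈ Finset.range 61, x ^ (k + 1) + ∑ k ∈ Finset.range 60, x ^ (k + 2)) := by
          refine mul_le_mul_of_nonneg_left ?_ hy0.le
          linarith
  have hadm : Renewal.Admissible spanOneFamily := fun s hs => (spanOneFamily_spec s hs).1
  obtain ⟨κ, hκ, h⟩ := Renewal.exists_mul_pow_le_pulledBridgeZ hadm nil_cons_mem_spanOneFamily hx0 hy0 hK
  have hxr : x⁻¹ = r := by rw [hx, inv_inv]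
  rw [hxr] at h
  exact log_le_pulledBridgeFreeEnergy_of_geometric 1 hy0 hκ hr0 h

/-- **`y_c(a) ≤ e^{κ(a)} − 2 + 4/(e^{κ(a)} − 2)` for `a ≥ 4`** (at the boundary `λ_B(y_c) = κ(a)` and `λ_B(y) ≥ log(y + 2 − 4/y)`).
[cite: JansevanRensburgWhittington2013, §4 Lemma 6 (arXiv v4 p. 13)] -/
theorem pulledCriticalPull_le_sharp {a : ℝ} (ha : 4 ≤ a) :
    pulledCriticalPull a ≤ adsRate a - 2 + 4 / (adsRate a - 2) := by
  have ha0 : 0 < a := by linarith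
  set E := adsRate a with hE
  set yc := pulledCriticalPull a with hyc
  have hEa : a ≤ E := self_le_adsRate ha0.le
  have hlow : E - 2 ≤ yc := adsRate_sub_two_le_pulledCriticalPull ha0
  have hyc2 : 2 ≤ yc := by linarith
  have hyc0 : 0 < yc := by linarith
  have hcross := pulledBridgeFreeEnergy_pulledCriticalPull ha0 (by linarith)
  have hlog : Real.log (yc + 2 - 4 / yc) ≤ Real.log E := by
    have h := log_add_two_sub_le_pulledBridgeFreeEnergy hyc2
    rw [hyc] at h
    rw [hcross, adsFreeEnergy, Real.exp_log ha0] at h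
    exact h
  have hpos : 0 < yc + 2 - 4 / yc := by
    have : 4 / yc ≤ 2 := by rw [div_le_iff₀ hyc0]; linarith
    linarith
  have hle : yc + 2 - 4 / yc ≤ E := (Real.log_le_log_iff hpos (adsRate_pos ha0.le)).1 hlog
  have h4 : 4 / yc ≤ 4 / (E - 2) := div_le_div_of_nonneg_left (by norm_num) (by linarith) hlow
  linarith

/-- **The phase boundary to order `a⁻¹`: `a + 1/a − 2 ≤ y_c(a) ≤ a − 2 + 1/a + 6/a² + 4/(a − 2)` for `a ≥ 6`** — so
`y_c(a) = a − 2 + O(1/a)` (print: `log y_c(a) ∼ log a`). [cite: JansevanRensburgWhittington2013, §4 Theorem 9 (arXiv v4 p. 14)] -/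
theorem pulledCriticalPull_window_sharp {a : ℝ} (ha : 6 ≤ a) :
    a + 1 / a - 2 ≤ pulledCriticalPull a ∧ pulledCriticalPull a ≤ a - 2 + 1 / a + 6 / a ^ 2 + 4 / (a - 2) := by
  have ha0 : 0 < a := by linarith
  refine ⟨(pulledCriticalPull_window (by linarith)).1, ?_⟩
  have hup := pulledCriticalPull_le_sharp (show (4:ℝ) ≤ a by linarith)
  obtain ⟨hElo, hEhi⟩ := adsRate_mem_Icc_exact ha
  have hE2 : a - 2 ≤ adsRate a - 2 := by linarith [self_le_adsRate ha0.le]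
  have h4 : 4 / (adsRate a - 2) ≤ 4 / (a - 2) := div_le_div_of_nonneg_left (by norm_num) (by linarith) hE2
  linarith

/-- **`y_c(a) − a → −2` as `a → ∞`: the adsorbed–ballistic boundary is asymptotically the line `y = a − 2`.**
[cite: JansevanRensburgWhittington2013, §4 Theorem 9 (arXiv v4 p. 14: «log y_c(a) = log(a μ_{d−1}) + o(log a)»)] -/
theorem tendsto_pulledCriticalPull_sub : Tendsto (fun a : ℝ => pulledCriticalPull a - a) atTop (𝓝 (-2)) := by
  have h1 : Tendsto (fun a : ℝ => 1 / a) atTop (𝓝 0) := tendsto_const_nhds.div_atTop tendsto_id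
  have hlow : Tendsto (fun a : ℝ => a + 1 / a - 2 - a) atTop (𝓝 (-2)) := by
    have := h1.sub (tendsto_const_nhds (x := (2:ℝ)))
    rw [zero_sub] at this
    refine this.congr fun a => ?_
    ring
  have hup : Tendsto (fun a : ℝ => a - 2 + 1 / a + 6 / a ^ 2 + 4 / (a - 2) - a) atTop (𝓝 (-2)) := by
    have h2 : Tendsto (fun a : ℝ => 6 / a ^ 2) atTop (𝓝 0) :=
      tendsto_const_nhds.div_atTop (tendsto_pow_atTop two_ne_zero)
    have h3 : Tendsto (fun a : ℝ => 4 / (a - 2)) atTop (𝓝 0) :=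
      tendsto_const_nhds.div_atTop (tendsto_atTop_add_const_right _ (-2) tendsto_id)
    have := (((tendsto_const_nhds (x := (-2:ℝ))).add h1).add h2).add h3
    simp only [add_zero] at this
    refine this.congr fun a => ?_
    ring
  refine tendsto_of_tendsto_of_tendsto_of_le_of_le' hlow hup ?_ ?_
  · filter_upwards [eventually_ge_atTop (6 : ℝ)] with a ha
    linarith [(pulledCriticalPull_window_sharp ha).1]
  · filter_upwards [eventually_ge_atTop (6 : ℝ)] with a ha
    linarith [(pulledCriticalPull_window_sharp ha).2]

/-! ### The large-force law of the pulled free energy on `ℤ²`: `e^{λ(y)} = y + 2 + O(1/y)` -/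

/-- **`y + 2 − 4/y ≤ e^{λ_B(y)} ≤ e^{λ(y)} ≤ y + 2` for `y ≥ 2`.** [cite: JansevanRensburgWhittington2013, §3.2 Theorem 8 and Corollary 2 (arXiv v4 p. 11: «λ(y) is asymptotic to log y»)] -/
theorem exp_pulledFreeEnergy_window {y : ℝ} (hy : 2 ≤ y) :
    y + 2 - 4 / y ≤ Real.exp (pulledBridgeFreeEnergy 2 y) ∧
      Real.exp (pulledBridgeFreeEnergy 2 y) ≤ Real.exp (max (Real.log (connectiveConstant 2)) (pulledBridgeFreeEnergy 2 y)) ∧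
      Real.exp (max (Real.log (connectiveConstant 2)) (pulledBridgeFreeEnergy 2 y)) ≤ y + 2 := by
  have hy0 : 0 < y := by linarith
  have hr0 : 0 < y + 2 - 4 / y := by
    have : 4 / y ≤ 2 := by rw [div_le_iff₀ hy0]; linarith
    linarith
  refine ⟨?_, Real.exp_le_exp.2 (le_max_right _ _), ?_⟩
  · have h := log_add_two_sub_le_pulledBridgeFreeEnergy hy
    calc y + 2 - 4 / y = Real.exp (Real.log (y + 2 - 4 / y)) := (Real.exp_log hr0).symm
      _ ≤ _ := Real.exp_le_exp.2 h
  · have h := pulledFreeEnergy_le_log_add_two (show (1:ℝ) ≤ y by linarith)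
    calc Real.exp (max (Real.log (connectiveConstant 2)) (pulledBridgeFreeEnergy 2 y))
        ≤ Real.exp (Real.log (y + 2)) := Real.exp_le_exp.2 h
      _ = y + 2 := Real.exp_log (by linarith)

/-- **`e^{λ_B(y)} − y → 2` as `y → ∞`**: at large force the pulled bridge gains exactly two lateral options per step
(the pulled analogue of the adsorption law `e^{κ(a)} − a → 0`). [cite: JansevanRensburgWhittington2013, §3.2 Corollary 2 (arXiv v4 p. 11)] -/
theorem tendsto_exp_pulledBridgeFreeEnergy_sub :
    Tendsto (fun y : ℝ => Real.exp (pulledBridgeFreeEnergy 2 y) - y) atTop (𝓝 2) := by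
  have hlow : Tendsto (fun y : ℝ => y + 2 - 4 / y - y) atTop (𝓝 2) := by
    have h1 : Tendsto (fun y : ℝ => 4 / y) atTop (𝓝 0) := tendsto_const_nhds.div_atTop tendsto_id
    have := (tendsto_const_nhds (x := (2:ℝ))).sub h1
    rw [sub_zero] at this
    refine this.congr fun y => ?_
    ring
  have hup : Tendsto (fun y : ℝ => y + 2 - y) atTop (𝓝 2) := by
    refine (tendsto_const_nhds (x := (2:ℝ))).congr fun y => ?_
    ring
  refine tendsto_of_tendsto_of_tendsto_of_le_of_le' hlow hup ?_ ?_
  · filter_upwards [eventually_ge_atTop (2 : ℝ)] with y hy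
    linarith [(exp_pulledFreeEnergy_window hy).1]
  · filter_upwards [eventually_ge_atTop (2 : ℝ)] with y hy
    obtain ⟨-, h2, h3⟩ := exp_pulledFreeEnergy_window hy
    linarith

end Literature.Probability.RandomPlanarGeometry.SAW.Zd
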